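import Summits.QuantumFields.YangMills.Theorems.BalabanUVNodesN15KingModelFullPropagatorTorusWalk
import Literature.MathematicalPhysics.QuantumFieldTheory.King1986.PropagatorDerivSupNorm

/-!
# BalabanUVNodes ∕ N15 — THE KING-MODEL RUNG, CURVED EDITION (PART T-c): THE HÖLDER ENTRY OF [B9] (3.43) AT `U ≡ 1` FOR KING'S FULL `A = 0`
# PROPAGATOR IN OPERATOR FORM — `|(A₀⁻¹f)(x′) − (A₀⁻¹f)(x)| ≤ C·|x − x′|·‖f‖_∞` (unit coordinates; Lipschitz, hence Hölder of every order
# `0 < α ≤ 1` on unit cubes), UNIFORMLY in `K`, the volume, the mass and the source: [Ba 4] (1.10) clause 2 summed along part T-a's torus walk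
# (Track A, DAG node N15 = NE2; FAN-OUT v1.1 §N15 s3 «KING-MODEL RUNG … + the one-line statement of what the curved case adds»)

HONEST FRAMING.  Count-neutral kernel bookkeeping (cell `pub-ymgap`, seat `pub-ymgap-dag-n15-e` g8; `--supports stmt-QuantumFields-20296
--as helper` = K3⁵ `SpineGivenEndpointR13SepCoP`, WORDS-141).  TEMPLATE LITERATURE, `A = 0`: King's ∕ Bałaban's full `A = 0` propagator `A₀⁻¹ = G_k(T_ε, 0)`
([King1986] (2.13) p. 653, Theorem 3.3 (3.7)–(3.8) p. 656 «see [Ba 4]»; [Ba 4] = [Balaban1983RegularityDecay] Theorem (1.10) p. 573, clause 2: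
«`|η⁻¹((G_k(Ω,A)f)(x + ηe_μ) − (G_k(Ω,A)f)(x))| ≤ c₀exp(−δ₀dist(x, supp f))‖f‖_∞`»); the HÖLDER ENTRY typed in [B9] = [Balaban1985BackgroundPropagators]
(3.43) p. 397 (the Hölder seminorm of `G(U)λ` over unit cubes, among the entries Theorem 3.1 asserts for the live propagator) is NOT given an η-rate shape by
`T4EtaRate` (header (4): «the Hölder entries (3.43)–(3.45) … are NOT given an η-rate shape here»).  THIS FILE decides the `U ≡ 1`, `A = 0` Hölder entry of
the FULL propagator in the model — a SHAPE consequence of (1.10) clause 2, NOT a printed proposition; NOT Bałaban's `G(U)`; NE2⁺ NOT PRINTED and not proved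
here; NOT a node discharge; nothing continuum ∕ ℝ⁴ ∕ OS ∕ mass-gap ∕ Clay.  0 `sorry`, 0 `def`, standard axioms.

THE POINT.  K-lit `PropagatorDerivSupNorm.fineOp_inv_deriv_mulVec_le_unif` ([Ba 4] (1.10) clause 2 in sup-norm operator form, King's spelling) bounds
ONE lattice step of `A₀⁻¹f` in the observation point: `|N·((A₀⁻¹f)(x + e_μ) − (A₀⁻¹f)(x))| ≤ c₀‖f‖_∞` for EVERY point, every level `K ≥ 1`
(`N = L^K`), every volume `M = sitesPerDir`, every mass `0 ≤ m² ≤ m₀²` and every source `f`.  Part T-a `abs_sub_le_of_ball_steps` turns a uniform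
one-step bound into a two-point bound along the coordinate walk of `≤ (d+1)|x − x′|` steps:
* ★★ **`fullPropOp_lipschitz_unif`** — `∃ C > 0` with `|(A₀⁻¹f)(x′) − (A₀⁻¹f)(x)| ≤ C·(|x − x′|∕N)·F` for all `|f| ≤ F`, all `x, x′`: the operator
  `A₀⁻¹` maps `ℓ^∞` into LIPSCHITZ functions of the unit-coordinate position `|x − x′|∕N`, uniformly in `K`, the volume and the mass;
* ★ **`fullPropOp_holder_unif`** (`0 < α ≤ 1`): `|x − x′| ≤ N` (the two points in a common unit cube's worth of distance) ⇒
  `|(A₀⁻¹f)(x′) − (A₀⁻¹f)(x)| ≤ C·(|x − x′|∕N)^α·F` — the (3.43)-type Hölder seminorm of `A₀⁻¹f` over unit cubes is `≤ C‖f‖_∞`, every order `α ≤ 1`.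
WHAT THE CURVED CASE ADDS (one line): for Bałaban's `G(U)λ` the entry (3.43) carries parallel transports and `α < 1` uniformly over `Reg335` (printed,
Theorem 3.1); its η-DIFFERENCE version (an NE2⁺ Hölder layer) is not printed and not typed.
HONEST SCOPE.  (i) `A = 0`, periodic b.c., Bałaban's volumes `M = sitesPerDir`, odd `L > 1`, `K ≥ 1`, `0 ≤ m² ≤ m₀²`; (ii) King's spelling `A₀ = N²(−Δ) + m²
+ a_KQ*Q`, `(A₀⁻¹f)` = `(fineOp N M (aK a L K) N² m²)⁻¹ *ᵥ f`; (iii) sup norm of the source only (no decay from the support displayed — (1.10)'s factor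
`e^{−δ₀dist(x, supp f)}` survives the walk with `dist` lowered by `|x − x′|`; not repeated); (iv) not Bałaban's `G(U)`; not a discharge.
Locators: [Balaban1983RegularityDecay] Theorem (1.10) p. 573; [King1986] (2.13) p. 653, Theorem 3.3 (3.7)–(3.8) p. 656, (3.62) p. 663;
[Balaban1985BackgroundPropagators] Thm 3.1 (3.43) p. 397.
-/

noncomputable section

namespace Summit.QuantumFields.YangMills.BalabanUVNodes.N15KingModelRung.Curved

open Real Finset Matrix
open Literature.MathematicalPhysics.QuantumFieldTheory.Balaban1983to89 (Params)
open Literature.MathematicalPhysics.QuantumFieldTheory.Balaban1983to89.B5Prop11Plancherel (Tor fine unitVec)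
open Literature.MathematicalPhysics.QuantumFieldTheory.King1986 (aK aK_pos)
open Literature.MathematicalPhysics.QuantumFieldTheory.King1986.Torus (fineOp tdistT tdistT_nonneg fineOp_inv_deriv_mulVec_le_unif)

/-- **THE OPERATOR `A₀⁻¹` IS LIPSCHITZ IN THE UNIT-COORDINATE POSITION, UNIFORMLY** ([Ba 4] (1.10) clause 2 summed along the torus walk): for
`d + 1 ≥ 1` dimensions, odd `L > 1`, `a > 0`, `m₀² ≥ 0` there is `C > 0` (a function of `d, L, a, m₀²`) such that for EVERY level `K ≥ 1` (Bałaban's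
volume `M = sitesPerDir`, `N = L^K` fine points per unit block), every mass `0 ≤ m² ≤ m₀²`, every source `f` with `|f| ≤ F` and ALL fine points `x, x′`:
`|(A₀⁻¹f)(x′) − (A₀⁻¹f)(x)| ≤ C·(|x − x′|_{fine}∕N)·F` — `|x − x′|∕N` is the unit-coordinate distance.  (`C = (d+1)·c₀`.)
[cite: Balaban1983RegularityDecay, Theorem (1.10) p.573; King1986, Theorem 3.3 (3.7)–(3.8) p.656; Balaban1985BackgroundPropagators, (3.43) p.397] -/
theorem fullPropOp_lipschitz_unif (d L : ℕ) (hL : Odd L ∧ 1 < L) {a : ℝ} (ha : 0 < a) {m0sq : ℝ} (hm0 : 0 ≤ m0sq) :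
    ∃ C : ℝ, 0 < C ∧ ∀ (P : Params), P.d = d + 1 → P.L = L → 1 ≤ P.K →
      ∀ (msq : ℝ), 0 ≤ msq → msq ≤ m0sq →
      ∀ (M : Fin P.d → ℕ) [∀ μ, NeZero (M μ)] (_hMK : ∀ μ, M μ = P.sitesPerDir P.K)
        (N : ℕ) [NeZero N] (_hN : N = P.L ^ P.K) (f : Tor (fine N M) → ℝ) (F : ℝ), (∀ y, |f y| ≤ F) →
        ∀ x x' : Tor (fine N M),
        |((fineOp N M (aK a P.L P.K) (((N : ℕ) : ℝ) ^ 2) msq)⁻¹ *ᵥ f) x'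
            - ((fineOp N M (aK a P.L P.K) (((N : ℕ) : ℝ) ^ 2) msq)⁻¹ *ᵥ f) x|
          ≤ C * (tdistT (fine N M) x x' / N) * F := by
  obtain ⟨c₀, hc₀, H⟩ := fineOp_inv_deriv_mulVec_le_unif (d + 1) L (Nat.succ_pos d) hL ha hm0
  refine ⟨((d + 1 : ℕ) : ℝ) * c₀, by positivity, ?_⟩
  intro P hPd hPL hK msq hmsq hcap M _ hMK N _ hN f F hF x x'
  have hN0 : (0 : ℝ) < N := by
    rw [hN]
    exact_mod_cast pow_pos (by rw [hPL]; omega) P.K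
  have hF0 : 0 ≤ F := (abs_nonneg (f x)).trans (hF x)
  -- the uniform one-step bound, everywhere (no ball restriction needed)
  set g : Tor (fine N M) → ℝ := fun w => ((fineOp N M (aK a P.L P.K) (((N : ℕ) : ℝ) ^ 2) msq)⁻¹ *ᵥ f) w with hgdef
  have hstep : ∀ w : Tor (fine N M), tdistT (fine N M) x w ≤ tdistT (fine N M) x x' → ∀ μ : Fin P.d,
      tdistT (fine N M) x (w + unitVec (fine N M) μ) ≤ tdistT (fine N M) x x' → |g (w + unitVec (fine N M) μ) - g w| ≤ c₀ * F / N := by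
    intro w _ μ _
    have h := H P hPd hPL hK msq hmsq hcap M hMK N hN f F hF w μ
    rw [abs_mul, abs_of_pos hN0] at h
    rw [le_div_iff₀ hN0, mul_comm]
    exact h
  have hwalk := abs_sub_le_of_ball_steps (fine N M) g x x' (by positivity : 0 ≤ c₀ * F / N) hstep
  have hdd : ((P.d : ℕ) : ℝ) = ((d + 1 : ℕ) : ℝ) := by rw [hPd]
  calc |g x' - g x| ≤ (P.d : ℝ) * tdistT (fine N M) x x' * (c₀ * F / N) := hwalk
    _ = ((d + 1 : ℕ) : ℝ) * c₀ * (tdistT (fine N M) x x' / N) * F := by rw [hdd]; ring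

/-- **THE (3.43)-TYPE HÖLDER ENTRY OF `A₀⁻¹f` OVER UNIT CUBES** (`0 < α ≤ 1`): under the same data, for fine points at unit-coordinate distance
`|x − x′|∕N ≤ 1`:  `|(A₀⁻¹f)(x′) − (A₀⁻¹f)(x)| ≤ C·(|x − x′|∕N)^α·F` — the Hölder seminorm of order `α` of `A₀⁻¹f` over any unit cube is `≤ C‖f‖_∞`,
uniformly in `K`, the volume and the mass (`q ≤ q^α` for `0 ≤ q ≤ 1`).  The `U ≡ 1`, `A = 0` case of the entry (3.43) for the FULL propagator,
decided in the model. [cite: Balaban1985BackgroundPropagators, Thm 3.1 (3.43) p.397; Balaban1983RegularityDecay, Theorem (1.10) p.573; King1986, (3.62) p.663] -/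
theorem fullPropOp_holder_unif (d L : ℕ) (hL : Odd L ∧ 1 < L) {a : ℝ} (ha : 0 < a) {m0sq : ℝ} (hm0 : 0 ≤ m0sq)
    {α : ℝ} (hα0 : 0 < α) (hα1 : α ≤ 1) :
    ∃ C : ℝ, 0 < C ∧ ∀ (P : Params), P.d = d + 1 → P.L = L → 1 ≤ P.K →
      ∀ (msq : ℝ), 0 ≤ msq → msq ≤ m0sq →
      ∀ (M : Fin P.d → ℕ) [∀ μ, NeZero (M μ)] (_hMK : ∀ μ, M μ = P.sitesPerDir P.K)
        (N : ℕ) [NeZero N] (_hN : N = P.L ^ P.K) (f : Tor (fine N M) → ℝ) (F : ℝ), (∀ y, |f y| ≤ F) →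
        ∀ x x' : Tor (fine N M), tdistT (fine N M) x x' ≤ N →
        |((fineOp N M (aK a P.L P.K) (((N : ℕ) : ℝ) ^ 2) msq)⁻¹ *ᵥ f) x'
            - ((fineOp N M (aK a P.L P.K) (((N : ℕ) : ℝ) ^ 2) msq)⁻¹ *ᵥ f) x|
          ≤ C * (tdistT (fine N M) x x' / N) ^ α * F := by
  obtain ⟨C, hC, H⟩ := fullPropOp_lipschitz_unif d L hL ha hm0
  refine ⟨C, hC, ?_⟩
  intro P hPd hPL hK msq hmsq hcap M _ hMK N _ hN f F hF x x' hcube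
  have h := H P hPd hPL hK msq hmsq hcap M hMK N hN f F hF x x'
  have hN0 : (0 : ℝ) < N := by
    rw [hN]
    exact_mod_cast pow_pos (by rw [hPL]; omega) P.K
  have hF0 : 0 ≤ F := (abs_nonneg (f x)).trans (hF x)
  set q : ℝ := tdistT (fine N M) x x' / N with hqdef
  have hq0 : 0 ≤ q := div_nonneg (tdistT_nonneg _ x x') hN0.le
  have hq1 : q ≤ 1 := by rw [hqdef, div_le_one hN0]; exact hcube
  have hqα : q ≤ q ^ α := by
    rcases hq0.eq_or_lt with h0 | hpos
    · rw [← h0, Real.zero_rpow hα0.ne']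
    · calc q = q ^ (1 : ℝ) := (Real.rpow_one q).symm
        _ ≤ q ^ α := Real.rpow_le_rpow_of_exponent_ge hpos hq1 hα1
  calc _ ≤ C * q * F := h
    _ ≤ C * q ^ α * F := mul_le_mul_of_nonneg_right (mul_le_mul_of_nonneg_left hqα hC.le) hF0

end Summit.QuantumFields.YangMills.BalabanUVNodes.N15KingModelRung.Curved
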